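import Mathlib
import Literature.MathematicalPhysics.QuantumLattice.EuclideanAction
import HarnessLib
import Summits.QuantumFields.YangMills.Theorems.SelfNormalisedSkewness.Negative.TreeLevelSkewnessVanishes

/-!
# Route `ThermalDescent`, deciding crux `ZeroTemperatureFloors` (stmt-QuantumFields-25390):
# BC5 rung (crux workfile `Lines/rung_maxwell.lean`, kernel-checked on the farm) — the thermal free
# Maxwell₄ field as a DECIDED SEPARATING MODEL
# (zero-temperature floor TRUE uniformly in the period; NT clause (ii) FALSE at every temperature)

Tribunal-w seat `ym-td-bc5w-1` (planner, gen 2; R3/RECORD framing; sorry-free, closes nothing).  Companion of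
`Theorems/ThermalDescentZeroTemperatureFloorsRung.lean` (the Hamiltonian caricature + assembly lemma, p609990)
and of the plan-only skeleton `Lines/rung.lean` (stubs `stub_thermalLimit`, `stub_vacuumCoupling`).  The
same content, split into ≤ 400-line modules `Theorems/ThermalDescentMaxwellRung{Defs,Kernel,Images,Window,
Chain,Floors}.lean` (namespace `…Theorems.ThermalDescent.MaxwellRung`), is proposed to the Theorems tree so
that the tribunal kernel can import the witness (`--witness …thermalMaxwell_zeroTemperatureFloor_cruxShape`);
this workfile is self-contained and route-independent (imports `Mathlib`, the Mathlib-only certificate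
`TreeLevelSkewnessVanishes`, and `Literature…EuclideanAction` for `thetaTest`).

**The crux.** `Theses.ThermalDescent.ZeroTemperatureFloors` asks, for a lattice representation and a
unit map `a(β) → 0`, for ONE test function `v` supported in a positive-time slab `{δ₁ < y₀ < δ₂}`
(`δ₁ > 0`) and ONE `ε > 0` with `ε ≤ Qrp_β((2L+1)³ × 2^k(2L+1))(a(β), v)` — the reflected
plaquette-energy covariance `Cov(B∘refl, B)` on the LONG tori of time extent `2^k(2L+1)` — for all
`β ≥ β₅`, `a(β)L ≥ Λ₅`, `k ≥ k₀`.  Its distinctive content relative to the sub-problem statement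
`BalabanLadder.NT` (hypercubic tori, clauses (i) two-point floor, (ii) connected three-point floor) is
the survival of the reflection floor in the ZERO-TEMPERATURE limit `k → ∞` (inverse temperature
`T = a·2^k(2L+1) → ∞`).

**The model (dictionary).** The free Maxwell field of `d = 4` at inverse temperature `T` (time
period `T`), in the normalisation of the tree's `maxwellKernel` (the model that refuted
`SelfNormalisedSkewness`; restated here route-independently, §0): field-strength covariance = the IMAGE SUM
`G_T(z) = K(H_T(z))`, `H_T(z) = Σ_{n∈ℤ} ∂∂|z + nTe₀|⁻²` (`thermalHess`, `thermalKernel`; entrywise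
`tsum`, absolutely convergent for `T > 0` — `summable_entry_img`); plaquette energy ↦ Wick square
`F² = F_{μν}F_{μν}`; `Qrp(v)` ↦ `2·R₂^T(v) = 2 ∫∫ v(x) v(θy) tr G_T(x−y)G_T(y−x)` (`thermalRing2`, Wick's
rule); NT's clause-(ii) three-point function ↦ `8·R₃^T` (`thermalRing3`); the vacuum `T = ∞` member is
`vacuumRing2 / vacuumRing3` (verbatim the tree's `maxwellRing2 / maxwellRing3`).  The coupling `β` is absent: the free field is already the
formal `β → ∞` limit of compact `U(1)` (with the crux's bare density the literal `U(1)` floor is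
`O(β⁻²) → 0`, false for a trivial normalisation reason — hence the free-field analogue, as for FRM).

**Rung (crux analogue TRUE — `thermalMaxwell_zeroTemperatureFloor`, sorry-free).** There is ONE
`κ > 0` (`κTh`, free of `ℓ` and `T`) such that at every scale `ℓ > 0` the `[0,1]`-valued slab bump
`w_ℓ` (centre `(ℓ/2)e₀`, radii `ℓ/16 < ℓ/8`, `tsupport ⊆ {ℓ/4 < y₀ < 3ℓ/4}`) has
`κ ≤ 2·R₂^T(w_ℓ)` for EVERY period `T ≥ 3ℓ`, and `κ ≤ 2·R₂(w_ℓ)` in the vacuum;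
`thermalMaxwell_zeroTemperatureFloor_cruxShape` restates it in the crux's quantifier shape
(`∃ v δ₁ δ₂ ε P₅, … ∀ P ≥ P₅, ∃ k₀, ∀ k ≥ k₀, ε ≤ 2·R₂^{2^k P}(v)`, with `k₀ = 0`).
MECHANISM (no limit is taken): `tr G_T(z)G_T(−z) = 2 tr H_T(z)² + (tr H_T)² ≥ 2 tr H_T(z)²`
(`kT_eq`), and `tr H_T² = Σ_{(n,m)∈ℤ²} tr (∂∂|z_n|⁻²)(∂∂|z_m|⁻²)` (`trace_thermalHess_sq_ge`, via
`tsum_mul_tsum_of_summable_norm`) with EVERY cross term non-negative,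
`tr (∂∂|a|⁻²)(∂∂|b|⁻²) = (64(a·b)² − 16|a|²|b|²)/(|a|⁶|b|⁶) ≥ 0` whenever `a, b` lie in the double cone
`4|a⃗|² ≤ a₀²` (`trace_hessInvSq_mul`, `cone_criterion`), which all images `z + nTe₀` of a window
separation do once `T ≥ 3ℓ` (`cone_img`); so the thermal density dominates the vacuum density
`96/|z|⁸` termwise (`kvac_le_kT`), and the vacuum floor is `ℓ`-free by `−8 = −2·dim[F²]`
homogeneity (`κTh_eq`).  Upper bounds (integrability): `|H_T(z)_{μρ}| ≤ C_ℓ·Σₙ(n²+1)⁻²` on the window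
(`abs_thermalHess_le`); measurability of `z ↦ H_T(z)` as the pointwise limit of symmetric partial sums
(`measurable_thermalHess_entry`).

**Separation (S's analogue FALSE in the SAME model — `thermalMaxwell_NT_clauseII_false`).** `H_T(z)`
is symmetric and traceless (`thermalHess_trace`: the trace commutes with the convergent image sum), so
the landed `treeLevelSkewness_vanishes` gives `tr G_T G_T G_T ≡ 0` pointwise and `R₃^T ≡ 0` for all
test functions at EVERY `T > 0` (`thermalRing3_eq_zero`), as in the vacuum (`vacuumRing3_eq_zero`):
NT's clause (ii) admits no floor in the model while the crux's floor clause holds uniformly down to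
zero temperature — `thermalMaxwell_separates`.  The witness thus exercises exactly the part of the crux
NT does not contain (uniformity in the time extent `2^k`), in a regime (abelian, free) where `NT` is
decided FALSE, and shows that no proof of `ZeroTemperatureFloors → NT(ii)` can avoid non-abelian input
(the route's declared residual `SkewFloors`).

NOTHING HERE PROVES `ZeroTemperatureFloors`, `NT`, or the Yang–Mills mass gap: this is free-field
Gaussian analysis (images, Wick squares) on `ℝ⁴`, a witness that the deciding crux has content of its
own outside NT's printed regime. [cite: OsterwalderSeilerAnnPhys1978, §2–3; Luscher1977; GlimmJaffe1987, §6.3, §7]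
-/

set_option autoImplicit false

open scoped SchwartzMap BigOperators Topology
open Literature.MathematicalPhysics.QuantumLattice
open MeasureTheory Filter Topology Matrix Metric Set

noncomputable section

namespace Summit.QuantumFields.YangMills.Cruxes.ZeroTemperatureFloors.MaxwellRung
open Summit.QuantumFields.YangMills.Theorems.SelfNormalisedSkewness.Negative

/-! ## §0 The free Maxwell₄ field-strength covariance (route-independent restatement)

These are verbatim the definitions `E4`, `nsq`, `hessInvSq`, `maxwellKernel`, `e₀` of
`Theorems/SelfNormalisedSkewness/Negative/SelfNormalisedSkewnessFalseOfMaxwellDominatedWindowScheme`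
(the model that refuted `SelfNormalisedSkewness` and carries FRM's BC5 witness), restated here over the
Mathlib-only certificate file `TreeLevelSkewnessVanishes` (`K`, `p1`, `p2`, `δ`,
`treeLevelSkewness_vanishes`) so that this witness does not sit in any route's rebuild cone. -/

/-- Euclidean `ℝ⁴`. [folklore] -/
abbrev E4 : Type := EuclideanSpace ℝ (Fin 4)

/-- `|x|²` as the polynomial `∑ᵢ xᵢ²`. [folklore] -/
def nsq (x : E4) : ℝ := ∑ i, x i ^ 2

/-- The Hessian of the harmonic propagator `|x|⁻²` of `d = 4` (the free massless two-point function up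
to `1/(4π²)`): `∂_μ∂_ρ|x|⁻² = (8x_μx_ρ − 2δ_{μρ}|x|²)/|x|⁶`; junk value `0` at `x = 0`. [folklore] -/
def hessInvSq (x : E4) : Matrix (Fin 4) (Fin 4) ℝ := fun μ ρ =>
  8 * x μ * x ρ / nsq x ^ 3 - 2 * δ μ ρ / nsq x ^ 2

/-- The Hessian is symmetric. [folklore] -/
theorem hessInvSq_isSymm (x : E4) : (hessInvSq x).IsSymm :=
  Matrix.IsSymm.ext fun i j => by
    unfold hessInvSq δ
    by_cases hij : i = j
    · subst hij; rfl
    · rw [if_neg hij, if_neg (Ne.symm hij)]; ring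

/-- The Hessian is traceless (`|x|⁻²` is harmonic in `d = 4`; junk `0` at the origin). [folklore] -/
theorem hessInvSq_trace (x : E4) : (hessInvSq x).trace = 0 := by
  have hsum : ∑ μ : Fin 4, 8 * x μ * x μ / nsq x ^ 3 = 8 * nsq x / nsq x ^ 3 := by
    rw [← Finset.sum_div, nsq, Finset.mul_sum]
    congr 1
    exact Finset.sum_congr rfl fun μ _ => by ring
  simp only [Matrix.trace, Matrix.diag, hessInvSq, δ, if_true, Finset.sum_sub_distrib, hsum,
    Finset.sum_const, Finset.card_univ, Fintype.card_fin, nsmul_eq_mul]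
  by_cases h0 : nsq x = 0
  · simp [h0]
  · field_simp
    ring

/-- **The free Maxwell field-strength covariance** `G(x) = K(∂∂|x|⁻²)` (`6 × 6`, planes `μ<ν`). [folklore] -/
def maxwellKernel (x : E4) : Matrix (Fin 6) (Fin 6) ℝ := K (hessInvSq x)

/-- The unit time vector. [folklore] -/
def e₀ : E4 := EuclideanSpace.single 0 1

/-! ## §A Kernel algebra: two-matrix traces, the cross-image closed form, the cone criterion -/

/-- `tr K(h)K(g) = 2 tr(hg) + tr h · tr g` for symmetric `h, g` (the derivation action on `Λ²ℝ⁴`).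
[folklore] -/
theorem trace_K_mul_K (h g : Matrix (Fin 4) (Fin 4) ℝ) (h10 : h 1 0 = h 0 1) (h20 : h 2 0 = h 0 2)
    (h30 : h 3 0 = h 0 3) (h21 : h 2 1 = h 1 2) (h31 : h 3 1 = h 1 3) (h32 : h 3 2 = h 2 3)
    (g10 : g 1 0 = g 0 1) (g20 : g 2 0 = g 0 2) (g30 : g 3 0 = g 0 3) (g21 : g 2 1 = g 1 2)
    (g31 : g 3 1 = g 1 3) (g32 : g 3 2 = g 2 3) :
    (K h * K g).trace = 2 * (h * g).trace + h.trace * g.trace := by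
  simp +decide [Matrix.trace, Matrix.mul_apply, Fin.sum_univ_succ, K, p1, p2, δ, h10, h20, h30, h21,
    h31, h32, g10, g20, g30, g21, g31, g32]
  ring

/-- Symmetric-matrix version. [folklore] -/
theorem trace_K_mul_K_of_isSymm {h g : Matrix (Fin 4) (Fin 4) ℝ} (hh : h.IsSymm) (hg : g.IsSymm) :
    (K h * K g).trace = 2 * (h * g).trace + h.trace * g.trace :=
  trace_K_mul_K h g (hh.apply 0 1) (hh.apply 0 2) (hh.apply 0 3) (hh.apply 1 2) (hh.apply 1 3)
    (hh.apply 2 3) (hg.apply 0 1) (hg.apply 0 2) (hg.apply 0 3) (hg.apply 1 2) (hg.apply 1 3)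
    (hg.apply 2 3)

/-- `hessInvSq` is even. [folklore] -/
theorem hessInvSq_neg (x : E4) : hessInvSq (-x) = hessInvSq x := by
  ext μ ρ
  simp [hessInvSq, nsq]

/-- `maxwellKernel` is even. [folklore] -/
theorem maxwellKernel_neg (x : E4) : maxwellKernel (-x) = maxwellKernel x := by
  rw [maxwellKernel, maxwellKernel, hessInvSq_neg]

/-- `nsq z = ‖z‖²`. [folklore] -/
theorem nsq_eq_norm_sq (z : E4) : nsq z = ‖z‖ ^ 2 := by
  rw [EuclideanSpace.real_norm_sq_eq]; rfl

/-- `0 ≤ nsq z`. [folklore] -/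
theorem nsq_nonneg (z : E4) : 0 ≤ nsq z := by
  rw [nsq_eq_norm_sq]; positivity

/-- A coordinate is bounded by the Euclidean norm. [folklore] -/
theorem abs_apply_le_norm (z : E4) (i : Fin 4) : |z i| ≤ ‖z‖ := by
  simpa [Real.norm_eq_abs] using PiLp.norm_apply_le z i

/-- The Euclidean inner product as the polynomial `∑ᵢ aᵢbᵢ`. [folklore] -/
def ip (a b : E4) : ℝ := ∑ i, a i * b i

/-- The spatial square `a₁² + a₂² + a₃²`. [folklore] -/
def spSq (a : E4) : ℝ := a 1 ^ 2 + a 2 ^ 2 + a 3 ^ 2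

/-- `|a|² = a₀² + |a⃗|²`. [folklore] -/
theorem nsq_eq_time_add_spSq (a : E4) : nsq a = a 0 ^ 2 + spSq a := by
  simp only [nsq, spSq, Fin.sum_univ_four]
  ring

/-- `0 ≤ |a⃗|²`. [folklore] -/
theorem spSq_nonneg (a : E4) : 0 ≤ spSq a := by
  unfold spSq; positivity

/-- **The cross-image closed form**: `tr (∂∂|a|⁻²)(∂∂|b|⁻²) = (64(a·b)² − 16|a|²|b|²)/(|a|⁶|b|⁶)`
(junk-consistent at `a = 0` or `b = 0`). [folklore] -/
theorem trace_hessInvSq_mul (a b : E4) :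
    (hessInvSq a * hessInvSq b).trace =
      (64 * ip a b ^ 2 - 16 * (nsq a * nsq b)) / (nsq a ^ 3 * nsq b ^ 3) := by
  by_cases ha : nsq a = 0
  · have hz : hessInvSq a = 0 := by
      ext μ ρ; simp [hessInvSq, ha]
    simp [hz, ha]
  by_cases hb : nsq b = 0
  · have hz : hessInvSq b = 0 := by
      ext μ ρ; simp [hessInvSq, hb]
    simp [hz, hb]
  have hna : nsq a = a 0 ^ 2 + a 1 ^ 2 + a 2 ^ 2 + a 3 ^ 2 := by
    simp [nsq, Fin.sum_univ_four]
  have hnb : nsq b = b 0 ^ 2 + b 1 ^ 2 + b 2 ^ 2 + b 3 ^ 2 := by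
    simp [nsq, Fin.sum_univ_four]
  have hip : ip a b = a 0 * b 0 + a 1 * b 1 + a 2 * b 2 + a 3 * b 3 := by
    simp [ip, Fin.sum_univ_four]
  simp only [Matrix.trace, Matrix.diag, Matrix.mul_apply, Fin.sum_univ_four, hessInvSq, δ]
  simp +decide only [Fin.isValue, if_true, if_false]
  rw [hip]
  field_simp
  rw [hna, hnb]
  ring

/-- The diagonal case: `tr (∂∂|x|⁻²)² = 48/|x|⁸`. [folklore] -/
theorem trace_hessInvSq_sq (x : E4) : (hessInvSq x * hessInvSq x).trace = 48 / nsq x ^ 4 := by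
  by_cases h0 : nsq x = 0
  · have hz : hessInvSq x = 0 := by
      ext μ ρ; simp [hessInvSq, h0]
    simp [hz, h0]
  · have hn : nsq x = x 0 ^ 2 + x 1 ^ 2 + x 2 ^ 2 + x 3 ^ 2 := by
      simp [nsq, Fin.sum_univ_four]
    simp only [Matrix.trace, Matrix.diag, Matrix.mul_apply, Fin.sum_univ_four, hessInvSq, δ]
    simp +decide only [Fin.isValue, if_true, if_false]
    field_simp
    rw [hn]
    ring

/-- **The cone criterion**: if both separations lie in the double cone `4·(spatial)² ≤ (time)²`
around the time axis, then `|a|²|b|² ≤ 4(a·b)²` (the angle between `a` and `±b` is at most `60°`).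
[folklore] -/
theorem cone_criterion {a b : E4} (ha : 4 * spSq a ≤ a 0 ^ 2) (hb : 4 * spSq b ≤ b 0 ^ 2) :
    nsq a * nsq b ≤ 4 * ip a b ^ 2 := by
  have hip : ip a b = a 0 * b 0 + (a 1 * b 1 + a 2 * b 2 + a 3 * b 3) := by
    simp [ip, Fin.sum_univ_four]; ring
  have hCS : (a 1 * b 1 + a 2 * b 2 + a 3 * b 3) ^ 2 ≤ spSq a * spSq b := by
    unfold spSq
    nlinarith [sq_nonneg (a 1 * b 2 - a 2 * b 1), sq_nonneg (a 1 * b 3 - a 3 * b 1),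
      sq_nonneg (a 2 * b 3 - a 3 * b 2)]
  have hSA := spSq_nonneg a
  have hSB := spSq_nonneg b
  have hSS : spSq a * spSq b ≤ (a 0 ^ 2 / 4) * (b 0 ^ 2 / 4) :=
    mul_le_mul (by linarith) (by linarith) hSB (by positivity)
  have h16 : 16 * (a 1 * b 1 + a 2 * b 2 + a 3 * b 3) ^ 2 ≤ a 0 ^ 2 * b 0 ^ 2 := by
    nlinarith
  have hL : nsq a * nsq b ≤ (5 / 4 * a 0 ^ 2) * (5 / 4 * b 0 ^ 2) := by
    rw [nsq_eq_time_add_spSq, nsq_eq_time_add_spSq]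
    exact mul_le_mul (by linarith) (by linarith) (by positivity) (by positivity)
  rw [hip]
  nlinarith [sq_nonneg (a 0 * b 0 + 4 * (a 1 * b 1 + a 2 * b 2 + a 3 * b 3)), h16, hL,
    sq_nonneg (a 0 * b 0), sq_nonneg (a 1 * b 1 + a 2 * b 2 + a 3 * b 3)]

/-- Under the cone criterion the cross-image trace is non-negative. [folklore] -/
theorem trace_hessInvSq_mul_nonneg {a b : E4} (h : nsq a * nsq b ≤ 4 * ip a b ^ 2) :
    0 ≤ (hessInvSq a * hessInvSq b).trace := by
  rw [trace_hessInvSq_mul]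
  apply div_nonneg
  · linarith
  · have := nsq_nonneg a; have := nsq_nonneg b; positivity

/-- Entry bound `|(∂∂|a|⁻²)_{μρ}| ≤ 10/|a|⁴` (junk-consistent at `a = 0`). [folklore] -/
theorem abs_hessInvSq_le (a : E4) (μ ρ : Fin 4) : |hessInvSq a μ ρ| ≤ 10 / nsq a ^ 2 := by
  by_cases h0 : nsq a = 0
  · simp [hessInvSq, h0]
  have hpos : 0 < nsq a := lt_of_le_of_ne (nsq_nonneg a) (Ne.symm h0)
  have hprod : |a μ * a ρ| ≤ nsq a := by
    rw [abs_mul, nsq_eq_norm_sq, sq]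
    exact mul_le_mul (abs_apply_le_norm a μ) (abs_apply_le_norm a ρ) (abs_nonneg _) (norm_nonneg _)
  have hδ : |δ μ ρ| ≤ 1 := by
    unfold δ; split_ifs <;> simp
  have h1 : |8 * a μ * a ρ / nsq a ^ 3| ≤ 8 / nsq a ^ 2 := by
    rw [abs_div, abs_of_pos (pow_pos hpos 3), mul_assoc, abs_mul, abs_of_pos (by norm_num : (0:ℝ) < 8),
      div_le_div_iff₀ (pow_pos hpos 3) (pow_pos hpos 2)]
    nlinarith [pow_pos hpos 2, pow_pos hpos 4]
  have h2 : |2 * δ μ ρ / nsq a ^ 2| ≤ 2 / nsq a ^ 2 := by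
    rw [abs_div, abs_of_pos (pow_pos hpos 2), abs_mul, abs_of_pos (by norm_num : (0:ℝ) < 2)]
    apply div_le_div_of_nonneg_right _ (pow_pos hpos 2).le
    nlinarith
  unfold hessInvSq
  calc |8 * a μ * a ρ / nsq a ^ 3 - 2 * δ μ ρ / nsq a ^ 2|
      ≤ |8 * a μ * a ρ / nsq a ^ 3| + |2 * δ μ ρ / nsq a ^ 2| := abs_sub _ _
    _ ≤ 8 / nsq a ^ 2 + 2 / nsq a ^ 2 := add_le_add h1 h2
    _ = 10 / nsq a ^ 2 := by ring




/-! ## §B Thermal images: the periodised Hessian `H_T(z) = Σₙ ∂∂|z + nTe₀|⁻²` -/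

/-- The `n`-th thermal image of the separation `z` at period (inverse temperature) `T`. [folklore] -/
def img (T : ℝ) (n : ℤ) (z : E4) : E4 := z + ((n : ℝ) * T) • e₀

/-- Time coordinate of the `n`-th image: `z₀ + nT`. [folklore] -/
@[simp] theorem img_apply_zero (T : ℝ) (n : ℤ) (z : E4) : img T n z 0 = z 0 + n * T := by
  simp [img, e₀]

/-- Spatial coordinates are unchanged by imaging (coordinate `1`). [folklore] -/
@[simp] theorem img_apply_one (T : ℝ) (n : ℤ) (z : E4) : img T n z 1 = z 1 := by
  simp [img, e₀]

/-- Spatial coordinates are unchanged by imaging (coordinate `2`). [folklore] -/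
@[simp] theorem img_apply_two (T : ℝ) (n : ℤ) (z : E4) : img T n z 2 = z 2 := by
  simp [img, e₀]

/-- Spatial coordinates are unchanged by imaging (coordinate `3`). [folklore] -/
@[simp] theorem img_apply_three (T : ℝ) (n : ℤ) (z : E4) : img T n z 3 = z 3 := by
  simp [img, e₀]

/-- The `0`-th image is `z` itself. [folklore] -/
@[simp] theorem img_zero (T : ℝ) (z : E4) : img T 0 z = z := by
  simp [img]

/-- Imaging preserves the spatial radius. [folklore] -/
theorem spSq_img (T : ℝ) (n : ℤ) (z : E4) : spSq (img T n z) = spSq z := by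
  simp [spSq]

/-- `|z + nTe₀|² = (z₀ + nT)² + |z⃗|²`. [folklore] -/
theorem nsq_img (T : ℝ) (n : ℤ) (z : E4) : nsq (img T n z) = (z 0 + n * T) ^ 2 + spSq z := by
  rw [nsq_eq_time_add_spSq, spSq_img, img_apply_zero]

/-- `a₀² ≤ |a|²`. [folklore] -/
theorem time_sq_le_nsq (a : E4) : a 0 ^ 2 ≤ nsq a := by
  rw [nsq_eq_time_add_spSq]; linarith [spSq_nonneg a]

/-- Images of `−z` are reflected images of `z`: `(−z) + nTe₀ = −(z − nTe₀)`. [folklore] -/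
theorem img_neg (T : ℝ) (n : ℤ) (z : E4) : img T n (-z) = -(img T (-n) z) := by
  simp only [img, Int.cast_neg, neg_mul, neg_smul]
  abel

/-! ### Measurability of the image entries -/

/-- Coordinates are continuous. [folklore] -/
theorem continuous_coord (i : Fin 4) : Continuous fun z : E4 => z i := by
  fun_prop

/-- `nsq` is continuous. [folklore] -/
theorem continuous_nsq : Continuous (nsq : E4 → ℝ) := by
  have : (nsq : E4 → ℝ) = fun z => ‖z‖ ^ 2 := funext nsq_eq_norm_sq
  rw [this]; fun_prop

/-- Each entry of the Hessian `∂∂|a|⁻²` is a measurable function of `a`. [folklore] -/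
theorem measurable_hessInvSq_entry (μ ρ : Fin 4) : Measurable fun a : E4 => hessInvSq a μ ρ := by
  have h1 : Measurable fun a : E4 => 8 * a μ * a ρ / nsq a ^ 3 :=
    (((continuous_const.mul (continuous_coord μ)).mul (continuous_coord ρ)).measurable).div
      (continuous_nsq.measurable.pow_const 3)
  have h2 : Measurable fun a : E4 => 2 * δ μ ρ / nsq a ^ 2 :=
    measurable_const.div (continuous_nsq.measurable.pow_const 2)
  exact h1.sub h2

/-- Each entry of the `n`-th image Hessian is a measurable function of the separation. [folklore] -/
theorem measurable_hessInvSq_img (T : ℝ) (n : ℤ) (μ ρ : Fin 4) :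
    Measurable fun z : E4 => hessInvSq (img T n z) μ ρ :=
  (measurable_hessInvSq_entry μ ρ).comp (measurable_id.add_const _)

/-! ### Summability of the image families at every point (`T > 0`) -/

/-- Far images are large: if `n ≠ 0` and `2|z₀| ≤ |n|T` then `|z + nTe₀|² ≥ n²T²/4`. [folklore] -/
theorem nsq_img_ge_far {T : ℝ} (hT : 0 < T) (z : E4) {n : ℤ} (hfar : 2 * |z 0| ≤ |(n : ℝ)| * T) :
    (n : ℝ) ^ 2 * T ^ 2 / 4 ≤ nsq (img T n z) := by
  have h1 : |(n : ℝ) * T| - |z 0| ≤ |z 0 + n * T| := by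
    have := abs_sub_abs_le_abs_sub ((n : ℝ) * T) (-(z 0))
    have h' : (n : ℝ) * T - -(z 0) = z 0 + n * T := by ring
    rw [h', abs_neg] at this
    exact this
  have h2 : |(n : ℝ)| * T / 2 ≤ |z 0 + n * T| := by
    rw [abs_mul, abs_of_pos hT] at h1
    linarith
  have h3 : (|(n : ℝ)| * T / 2) ^ 2 ≤ (z 0 + n * T) ^ 2 := by
    rw [← sq_abs (z 0 + n * T)]
    exact pow_le_pow_left₀ (by positivity) h2 2
  calc (n : ℝ) ^ 2 * T ^ 2 / 4 = (|(n : ℝ)| * T / 2) ^ 2 := by rw [div_pow, mul_pow, sq_abs]; ring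
    _ ≤ (z 0 + n * T) ^ 2 := h3
    _ ≤ nsq (img T n z) := by rw [← img_apply_zero]; exact time_sq_le_nsq _

/-- Entry bound on far images: `|(∂∂|z+nTe₀|⁻²)_{μρ}| ≤ 160/(n⁴T⁴)`. [folklore] -/
theorem abs_entry_img_le_far {T : ℝ} (hT : 0 < T) (z : E4) {n : ℤ} (hn : n ≠ 0)
    (hfar : 2 * |z 0| ≤ |(n : ℝ)| * T) (μ ρ : Fin 4) :
    |hessInvSq (img T n z) μ ρ| ≤ 160 / T ^ 4 * (1 / (n : ℝ) ^ 4) := by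
  have hn' : (n : ℝ) ≠ 0 := Int.cast_ne_zero.mpr hn
  have hq : 0 < (n : ℝ) ^ 2 * T ^ 2 / 4 := by positivity
  have hge := nsq_img_ge_far hT z hfar
  calc |hessInvSq (img T n z) μ ρ| ≤ 10 / nsq (img T n z) ^ 2 := abs_hessInvSq_le _ μ ρ
    _ ≤ 10 / ((n : ℝ) ^ 2 * T ^ 2 / 4) ^ 2 :=
        div_le_div_of_nonneg_left (by norm_num) (by positivity) (pow_le_pow_left₀ hq.le hge 2)
    _ = 160 / T ^ 4 * (1 / (n : ℝ) ^ 4) := by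
        field_simp
        ring

/-- **Every image family is summable** (`T > 0`, any separation, any entry). [folklore] -/
theorem summable_entry_img {T : ℝ} (hT : 0 < T) (z : E4) (μ ρ : Fin 4) :
    Summable fun n : ℤ => hessInvSq (img T n z) μ ρ := by
  have hg : Summable fun n : ℤ => 160 / T ^ 4 * (1 / (n : ℝ) ^ 4) :=
    (Real.summable_one_div_int_pow.mpr (by norm_num)).mul_left _
  refine Summable.of_norm_bounded_eventually hg ?_
  rw [Filter.eventually_cofinite]
  set N : ℤ := ⌈2 * |z 0| / T⌉ with hN
  refine (Set.finite_Icc (-N) N).subset fun n hn => ?_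
  by_contra hout
  apply hn
  have hN0 : 0 ≤ N := by
    rw [hN]; exact Int.ceil_nonneg (by positivity)
  rw [Set.mem_Icc, not_and_or, not_le, not_le] at hout
  have hN0' : (0 : ℝ) ≤ N := by exact_mod_cast hN0
  have habs : (N : ℝ) + 1 ≤ |(n : ℝ)| := by
    rcases hout with h | h
    · have h' : (n : ℝ) ≤ -(N : ℝ) - 1 := by exact_mod_cast (by omega : n ≤ -N - 1)
      have h'' : |(n : ℝ)| = -(n : ℝ) := abs_of_neg (by linarith)
      linarith
    · have h' : (N : ℝ) + 1 ≤ (n : ℝ) := by exact_mod_cast (by omega : N + 1 ≤ n)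
      have h'' : |(n : ℝ)| = (n : ℝ) := abs_of_pos (by linarith)
      linarith
  have hn0 : n ≠ 0 := by
    rintro rfl
    simp at habs
    linarith
  have hceil : 2 * |z 0| / T ≤ (N : ℝ) := by rw [hN]; exact Int.le_ceil _
  have hfar : 2 * |z 0| ≤ |(n : ℝ)| * T := by
    have : 2 * |z 0| / T * T = 2 * |z 0| := div_mul_cancel₀ _ hT.ne'
    nlinarith
  simpa [Real.norm_eq_abs] using abs_entry_img_le_far hT z hn0 hfar μ ρ

/-- The periodised Hessian (thermal image sum, entry by entry):
`H_T(z)_{μρ} = Σ_{n∈ℤ} (∂∂|z + nTe₀|⁻²)_{μρ}` — the Hessian of the periodised harmonic propagator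
`Σₙ |z + nTe₀|⁻²`, i.e. of the free massless two-point function at inverse temperature `T` (up to
`1/(4π²)`). [folklore] -/
def thermalHess (T : ℝ) (z : E4) : Matrix (Fin 4) (Fin 4) ℝ := fun μ ρ =>
  ∑' n : ℤ, hessInvSq (img T n z) μ ρ

/-- **The thermal free-Maxwell field-strength covariance** `G_T(z) = K(H_T(z))` (`6 × 6`, planes
`μ<ν`): the image sum of the tree's `maxwellKernel`. [folklore] -/
def thermalKernel (T : ℝ) (z : E4) : Matrix (Fin 6) (Fin 6) ℝ := K (thermalHess T z)

/-- `H_T(z)` is symmetric. [folklore] -/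
theorem thermalHess_isSymm (T : ℝ) (z : E4) : (thermalHess T z).IsSymm :=
  Matrix.IsSymm.ext fun μ ρ => by
    unfold thermalHess
    exact tsum_congr fun n => (hessInvSq_isSymm _).apply μ ρ

/-- `H_T` is even. [folklore] -/
theorem thermalHess_neg (T : ℝ) (z : E4) : thermalHess T (-z) = thermalHess T z := by
  ext μ ρ
  unfold thermalHess
  have h1 : (fun n : ℤ => hessInvSq (img T n (-z)) μ ρ) =
      fun n : ℤ => (fun m : ℤ => hessInvSq (img T m z) μ ρ) ((Equiv.neg ℤ) n) := by
    funext n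
    simp only [Equiv.neg_apply, img_neg, hessInvSq_neg]
  rw [h1]
  exact (Equiv.neg ℤ).tsum_eq (fun m : ℤ => hessInvSq (img T m z) μ ρ)

/-- `G_T` is even. [folklore] -/
theorem thermalKernel_neg (T : ℝ) (z : E4) : thermalKernel T (-z) = thermalKernel T z := by
  rw [thermalKernel, thermalKernel, thermalHess_neg]

/-- `H_T` is traceless (`T > 0`; the trace commutes with the convergent image sum). [folklore] -/
theorem thermalHess_trace {T : ℝ} (hT : 0 < T) (z : E4) : (thermalHess T z).trace = 0 := by
  have h1 : (thermalHess T z).trace = ∑ μ, ∑' n : ℤ, hessInvSq (img T n z) μ μ := by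
    simp [Matrix.trace, thermalHess]
  rw [h1, ← Summable.tsum_finsetSum (fun μ _ => summable_entry_img hT z μ μ)]
  have h2 : (fun n : ℤ => ∑ μ, hessInvSq (img T n z) μ μ) = fun _ => 0 := by
    funext n
    have := hessInvSq_trace (img T n z)
    simpa [Matrix.trace] using this
  rw [h2, tsum_zero]

/-- The entries of `H_T` are measurable functions of the separation (`T > 0`): pointwise limits of
the symmetric partial image sums. [folklore] -/
theorem measurable_thermalHess_entry {T : ℝ} (hT : 0 < T) (μ ρ : Fin 4) :
    Measurable fun z : E4 => thermalHess T z μ ρ := by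
  let F : ℕ → E4 → ℝ := fun N z => ∑ n ∈ Finset.Icc (-(N : ℤ)) N, hessInvSq (img T n z) μ ρ
  have hF : ∀ N, Measurable (F N) := fun N =>
    Finset.measurable_sum _ fun n _ => measurable_hessInvSq_img T n μ ρ
  refine measurable_of_tendsto_metrizable' atTop hF ?_
  rw [tendsto_pi_nhds]
  intro z
  have h1 : Tendsto (fun N : ℕ => Finset.Icc (-(N : ℤ)) N) atTop atTop :=
    tendsto_atTop_finset_of_monotone (fun a b hab => Finset.Icc_subset_Icc (by omega) (by omega))
      (fun n => ⟨n.natAbs, by simpa using ⟨neg_abs_le n, le_abs_self n⟩⟩)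
  exact (summable_entry_img hT z μ ρ).hasSum.comp h1

/-! ### The thermal even-ring density `k_T(z) = tr G_T(z)G_T(−z)` -/

/-- The thermal even-ring density `k_T(z) = tr G_T(z)G_T(−z)` (one half of the Gaussian covariance
density of the Wick square `F²` at the reflected pair, inverse temperature `T`). [folklore] -/
def kT (T : ℝ) (z : E4) : ℝ := (thermalKernel T z * thermalKernel T (-z)).trace

/-- `k_T = 2 tr H_T² + (tr H_T)²`. [folklore] -/
theorem kT_eq (T : ℝ) (z : E4) :
    kT T z = 2 * (thermalHess T z * thermalHess T z).trace + (thermalHess T z).trace ^ 2 := by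
  rw [kT, thermalKernel_neg, thermalKernel,
    trace_K_mul_K_of_isSymm (thermalHess_isSymm T z) (thermalHess_isSymm T z), sq]

/-- `tr H² = Σ_{μρ} H_{μρ}H_{ρμ}`. [folklore] -/
theorem trace_sq_eq_sum (H : Matrix (Fin 4) (Fin 4) ℝ) :
    (H * H).trace = ∑ μ, ∑ ρ, H μ ρ * H ρ μ := by
  simp [Matrix.trace, Matrix.mul_apply]

/-- `tr H² ≥ 0` for symmetric `H`. [folklore] -/
theorem trace_sq_nonneg_of_isSymm {H : Matrix (Fin 4) (Fin 4) ℝ} (hH : H.IsSymm) :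
    0 ≤ (H * H).trace := by
  rw [trace_sq_eq_sum]
  refine Finset.sum_nonneg fun μ _ => Finset.sum_nonneg fun ρ _ => ?_
  rw [hH.apply ρ μ]  -- `H μ ρ * H ρ μ = H μ ρ * H μ ρ`? we rewrite `H ρ μ`… see check
  exact mul_self_nonneg _

/-- `k_T ≥ 0` everywhere. [folklore] -/
theorem kT_nonneg (T : ℝ) (z : E4) : 0 ≤ kT T z := by
  rw [kT_eq]
  have := trace_sq_nonneg_of_isSymm (thermalHess_isSymm T z)
  positivity

/-- `k_T` is measurable (`T > 0`). [folklore] -/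
theorem measurable_kT {T : ℝ} (hT : 0 < T) : Measurable (kT T) := by
  have h : kT T = fun z => 2 * ∑ μ, ∑ ρ, thermalHess T z μ ρ * thermalHess T z ρ μ +
      (∑ μ, thermalHess T z μ μ) ^ 2 := by
    funext z
    rw [kT_eq, trace_sq_eq_sum]
    simp [Matrix.trace]
  rw [h]
  have hE := measurable_thermalHess_entry hT
  refine ((Finset.measurable_sum _ fun μ _ => Finset.measurable_sum _ fun ρ _ =>
    (hE μ ρ).mul (hE ρ μ)).const_mul 2).add ((Finset.measurable_sum _ fun μ _ => hE μ μ).pow_const 2)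



/-! ### The separation window `W_ℓ` and uniform image bounds for periods `T ≥ 3ℓ` -/

/-- The window of separations `z = x − y` between a slab mode at scale `ℓ` and its reflection:
time component in `[3ℓ/4, 5ℓ/4]`, spatial radius `≤ ℓ/4`. [this route] -/
def W (ℓ : ℝ) : Set E4 := {z | 3 * ℓ / 4 ≤ z 0 ∧ z 0 ≤ 5 * ℓ / 4 ∧ 16 * spSq z ≤ ℓ ^ 2}

/-- **All images stay in the time cone, quantitatively**: for `z ∈ W_ℓ`, `T ≥ 3ℓ` and every `n ∈ ℤ`,
`(z₀ + nT)² ≥ (9ℓ²/16)(n² + 1)`. [this route] -/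
theorem time_img_sq_ge {ℓ T : ℝ} (hℓ : 0 < ℓ) (hT : 3 * ℓ ≤ T) {z : E4} (hz : z ∈ W ℓ) (n : ℤ) :
    9 * ℓ ^ 2 / 16 * ((n : ℝ) ^ 2 + 1) ≤ (z 0 + n * T) ^ 2 := by
  obtain ⟨hz1, hz2, -⟩ := hz
  rcases lt_trichotomy n 0 with hn | rfl | hn
  · have hn' : (n : ℝ) ≤ -1 := by exact_mod_cast (show n ≤ -1 by omega)
    have h1 : (n : ℝ) * T ≤ 3 * ℓ * n := by nlinarith
    have h2 : z 0 + n * T ≤ 5 * ℓ / 4 + 3 * ℓ * n := by linarith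
    have h3 : 5 * ℓ / 4 + 3 * ℓ * n ≤ 0 := by nlinarith
    have h4 : (5 * ℓ / 4 + 3 * ℓ * n) ^ 2 ≤ (z 0 + n * T) ^ 2 := by nlinarith
    have h5 : 0 ≤ (-(n : ℝ) - 1) * (-(n : ℝ)) := mul_nonneg (by linarith) (by linarith)
    have h6 : (5 * ℓ / 4 + 3 * ℓ * n) ^ 2 - 9 * ℓ ^ 2 / 16 * ((n : ℝ) ^ 2 + 1) =
        ℓ ^ 2 * (135 / 16 * ((-(n : ℝ) - 1) * (-(n : ℝ))) + 15 / 16 * (-(n : ℝ)) + 1) := by ring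
    have h7 : 0 ≤ ℓ ^ 2 * (135 / 16 * ((-(n : ℝ) - 1) * (-(n : ℝ))) + 15 / 16 * (-(n : ℝ)) + 1) :=
      mul_nonneg (sq_nonneg ℓ) (by nlinarith)
    linarith
  · simp only [Int.cast_zero, zero_mul, add_zero]
    nlinarith
  · have hn' : (1 : ℝ) ≤ n := by exact_mod_cast (show 1 ≤ n by omega)
    have h1 : 3 * ℓ * n ≤ (n : ℝ) * T := by nlinarith
    have h2 : 3 * ℓ * n ≤ z 0 + n * T := by linarith
    have h3 : 0 ≤ 3 * ℓ * n := by positivity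
    have h4 : (3 * ℓ * n) ^ 2 ≤ (z 0 + n * T) ^ 2 := pow_le_pow_left₀ h3 h2 2
    have h5 : 0 ≤ ℓ ^ 2 * ((n : ℝ) ^ 2 - 1) := mul_nonneg (sq_nonneg ℓ) (by nlinarith)
    nlinarith [sq_nonneg ℓ]

/-- All images are uniformly far from the origin on the window: `|z_n|² ≥ (9ℓ²/16)(n²+1)`. [this route] -/
theorem nsq_img_ge {ℓ T : ℝ} (hℓ : 0 < ℓ) (hT : 3 * ℓ ≤ T) {z : E4} (hz : z ∈ W ℓ) (n : ℤ) :
    9 * ℓ ^ 2 / 16 * ((n : ℝ) ^ 2 + 1) ≤ nsq (img T n z) := by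
  rw [nsq_img]
  linarith [time_img_sq_ge hℓ hT hz n, spSq_nonneg z]

/-- All images of a window separation lie in the double cone `4|a⃗|² ≤ a₀²` (`T ≥ 3ℓ`). [this route] -/
theorem cone_img {ℓ T : ℝ} (hℓ : 0 < ℓ) (hT : 3 * ℓ ≤ T) {z : E4} (hz : z ∈ W ℓ) (n : ℤ) :
    4 * spSq (img T n z) ≤ (img T n z) 0 ^ 2 := by
  rw [spSq_img, img_apply_zero]
  have h1 := time_img_sq_ge hℓ hT hz n
  have h2 : 9 * ℓ ^ 2 / 16 ≤ 9 * ℓ ^ 2 / 16 * ((n : ℝ) ^ 2 + 1) :=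
    le_mul_of_one_le_right (by positivity) (by nlinarith)
  have h3 : 16 * spSq z ≤ ℓ ^ 2 := hz.2.2
  nlinarith [sq_nonneg ℓ]

/-- **Every cross-image term is non-negative on the window**: `tr (∂∂|z_n|⁻²)(∂∂|z_m|⁻²) ≥ 0` for all
`n, m ∈ ℤ` (`z ∈ W_ℓ`, `T ≥ 3ℓ`) — all images lie in the `60°` double cone about the time axis.
[this route] -/
theorem cross_nonneg {ℓ T : ℝ} (hℓ : 0 < ℓ) (hT : 3 * ℓ ≤ T) {z : E4} (hz : z ∈ W ℓ) (n m : ℤ) :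
    0 ≤ (hessInvSq (img T n z) * hessInvSq (img T m z)).trace :=
  trace_hessInvSq_mul_nonneg (cone_criterion (cone_img hℓ hT hz n) (cone_img hℓ hT hz m))

/-- The uniform entry constant `C_ℓ = 10·(16/(9ℓ²))²`. [this route] -/
def Cb (ℓ : ℝ) : ℝ := 10 * (16 / (9 * ℓ ^ 2)) ^ 2

/-- `0 ≤ C_ℓ`. [this route] -/
theorem Cb_nonneg (ℓ : ℝ) : 0 ≤ Cb ℓ := by unfold Cb; positivity

/-- Uniform entry bound on the window: `|(∂∂|z_n|⁻²)_{μρ}| ≤ C_ℓ/(n² + 1)²`. [this route] -/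
theorem abs_entry_img_le {ℓ T : ℝ} (hℓ : 0 < ℓ) (hT : 3 * ℓ ≤ T) {z : E4} (hz : z ∈ W ℓ) (n : ℤ)
    (μ ρ : Fin 4) : |hessInvSq (img T n z) μ ρ| ≤ Cb ℓ * (1 / ((n : ℝ) ^ 2 + 1) ^ 2) := by
  have hq : 0 < 9 * ℓ ^ 2 / 16 * ((n : ℝ) ^ 2 + 1) := by positivity
  have hge := nsq_img_ge hℓ hT hz n
  have hℓ0 : ℓ ≠ 0 := hℓ.ne'
  calc |hessInvSq (img T n z) μ ρ| ≤ 10 / nsq (img T n z) ^ 2 := abs_hessInvSq_le _ μ ρ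
    _ ≤ 10 / (9 * ℓ ^ 2 / 16 * ((n : ℝ) ^ 2 + 1)) ^ 2 :=
        div_le_div_of_nonneg_left (by norm_num) (by positivity) (pow_le_pow_left₀ hq.le hge 2)
    _ = Cb ℓ * (1 / ((n : ℝ) ^ 2 + 1) ^ 2) := by
        unfold Cb
        field_simp

/-- `Σ_{n∈ℤ} (n²+1)⁻²` converges. [folklore] -/
theorem summable_invSq : Summable fun n : ℤ => 1 / ((n : ℝ) ^ 2 + 1) ^ 2 := by
  have hnat : Summable fun n : ℕ => 1 / ((n : ℝ) ^ 2 + 1) ^ 2 := by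
    have hf : Summable fun n : ℕ => 4 * (1 / (n : ℝ) ^ 4) :=
      (Real.summable_one_div_nat_pow.mpr (by norm_num)).mul_left 4
    have h4 : Summable fun n : ℕ => 4 * (1 / ((n + 1 : ℕ) : ℝ) ^ 4) :=
      (summable_nat_add_iff (f := fun n : ℕ => 4 * (1 / (n : ℝ) ^ 4)) 1).mpr hf
    refine Summable.of_nonneg_of_le (fun n => by positivity) (fun n => ?_) h4
    have hn : (0 : ℝ) ≤ n := n.cast_nonneg
    have hkey : 0 ≤ ((n : ℝ) - 1) ^ 2 * (3 * (n : ℝ) ^ 2 + 2 * n + 3) :=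
      mul_nonneg (sq_nonneg _) (by positivity)
    rw [Nat.cast_succ, div_le_iff₀ (by positivity)]
    rw [show 4 * (1 / ((n : ℝ) + 1) ^ 4) * (((n : ℝ)) ^ 2 + 1) ^ 2 =
      4 * ((n : ℝ) ^ 2 + 1) ^ 2 / ((n : ℝ) + 1) ^ 4 by ring, le_div_iff₀ (by positivity)]
    nlinarith
  refine Summable.of_nat_of_neg ?_ ?_
  · simpa using hnat
  · simpa using hnat

/-- `S = Σ_{n∈ℤ} (n²+1)⁻²`. [folklore] -/
def Sζ : ℝ := ∑' n : ℤ, 1 / ((n : ℝ) ^ 2 + 1) ^ 2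

/-- `0 ≤ S`. [folklore] -/
theorem Sζ_nonneg : 0 ≤ Sζ := tsum_nonneg fun n => by positivity

/-- On the window the image entry families are absolutely summable, dominated by `C_ℓ (n²+1)⁻²`. [this route] -/
theorem summable_norm_entry_img {ℓ T : ℝ} (hℓ : 0 < ℓ) (hT : 3 * ℓ ≤ T) {z : E4} (hz : z ∈ W ℓ)
    (μ ρ : Fin 4) : Summable fun n : ℤ => ‖hessInvSq (img T n z) μ ρ‖ :=
  Summable.of_nonneg_of_le (fun _ => norm_nonneg _)
    (fun n => by rw [Real.norm_eq_abs]; exact abs_entry_img_le hℓ hT hz n μ ρ)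
    (summable_invSq.mul_left (Cb ℓ))

/-- **Uniform bound on the periodised Hessian on the window**: `|H_T(z)_{μρ}| ≤ C_ℓ·S`, for every
period `T ≥ 3ℓ`. [this route] -/
theorem abs_thermalHess_le {ℓ T : ℝ} (hℓ : 0 < ℓ) (hT : 3 * ℓ ≤ T) {z : E4} (hz : z ∈ W ℓ)
    (μ ρ : Fin 4) : |thermalHess T z μ ρ| ≤ Cb ℓ * Sζ := by
  have hg : HasSum (fun n : ℤ => Cb ℓ * (1 / ((n : ℝ) ^ 2 + 1) ^ 2)) (Cb ℓ * Sζ) :=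
    summable_invSq.hasSum.mul_left (Cb ℓ)
  have := tsum_of_norm_bounded hg
    (fun n => by rw [Real.norm_eq_abs]; exact abs_entry_img_le hℓ hT hz n μ ρ)
  rwa [Real.norm_eq_abs] at this

/-- **The image expansion and its positivity**: on the window, for `T ≥ 3ℓ`,
`tr H_T(z)² = Σ_{(n,m)∈ℤ²} tr (∂∂|z_n|⁻²)(∂∂|z_m|⁻²) ≥ tr (∂∂|z|⁻²)² = 48/|z|⁸` — every cross
term being non-negative (`cross_nonneg`), the thermal density dominates the vacuum one TERMWISE,
with no limit taken. [this route] -/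
theorem trace_thermalHess_sq_ge {ℓ T : ℝ} (hℓ : 0 < ℓ) (hT : 3 * ℓ ≤ T) {z : E4} (hz : z ∈ W ℓ) :
    48 / nsq z ^ 4 ≤ (thermalHess T z * thermalHess T z).trace := by
  have hsn : ∀ μ ρ : Fin 4, Summable fun n : ℤ => ‖hessInvSq (img T n z) μ ρ‖ :=
    fun μ ρ => summable_norm_entry_img hℓ hT hz μ ρ
  have hprod : ∀ μ ρ : Fin 4, Summable fun p : ℤ × ℤ =>
      hessInvSq (img T p.1 z) μ ρ * hessInvSq (img T p.2 z) ρ μ :=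
    fun μ ρ => summable_mul_of_summable_norm (f := fun n : ℤ => hessInvSq (img T n z) μ ρ)
      (g := fun n : ℤ => hessInvSq (img T n z) ρ μ) (hsn μ ρ) (hsn ρ μ)
  have h1 : (thermalHess T z * thermalHess T z).trace =
      ∑ μ, ∑ ρ, (∑' n : ℤ, hessInvSq (img T n z) μ ρ) * (∑' m : ℤ, hessInvSq (img T m z) ρ μ) :=
    trace_sq_eq_sum _
  have h2 : ∀ μ ρ : Fin 4,
      (∑' n : ℤ, hessInvSq (img T n z) μ ρ) * (∑' m : ℤ, hessInvSq (img T m z) ρ μ) =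
        ∑' p : ℤ × ℤ, hessInvSq (img T p.1 z) μ ρ * hessInvSq (img T p.2 z) ρ μ :=
    fun μ ρ => tsum_mul_tsum_of_summable_norm (hsn μ ρ) (hsn ρ μ)
  have h3 : ∀ μ : Fin 4,
      ∑ ρ, ∑' p : ℤ × ℤ, hessInvSq (img T p.1 z) μ ρ * hessInvSq (img T p.2 z) ρ μ =
        ∑' p : ℤ × ℤ, ∑ ρ, hessInvSq (img T p.1 z) μ ρ * hessInvSq (img T p.2 z) ρ μ :=
    fun μ => (Summable.tsum_finsetSum fun ρ _ => hprod μ ρ).symm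
  have h4 : ∑ μ, ∑' p : ℤ × ℤ, ∑ ρ, hessInvSq (img T p.1 z) μ ρ * hessInvSq (img T p.2 z) ρ μ =
      ∑' p : ℤ × ℤ, ∑ μ, ∑ ρ, hessInvSq (img T p.1 z) μ ρ * hessInvSq (img T p.2 z) ρ μ :=
    (Summable.tsum_finsetSum fun μ _ => summable_sum fun ρ _ => hprod μ ρ).symm
  have h5 : ∀ p : ℤ × ℤ, ∑ μ, ∑ ρ, hessInvSq (img T p.1 z) μ ρ * hessInvSq (img T p.2 z) ρ μ =
      (hessInvSq (img T p.1 z) * hessInvSq (img T p.2 z)).trace :=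
    fun p => by simp [Matrix.trace, Matrix.mul_apply]
  have hexp : (thermalHess T z * thermalHess T z).trace =
      ∑' p : ℤ × ℤ, (hessInvSq (img T p.1 z) * hessInvSq (img T p.2 z)).trace := by
    rw [h1]
    simp_rw [h2, h3]
    rw [h4]
    exact tsum_congr h5
  have hsumm : Summable fun p : ℤ × ℤ =>
      (hessInvSq (img T p.1 z) * hessInvSq (img T p.2 z)).trace :=
    (summable_sum (s := Finset.univ) fun μ (_ : μ ∈ Finset.univ) =>
      summable_sum (s := Finset.univ) fun ρ (_ : ρ ∈ Finset.univ) => hprod μ ρ).congr h5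
  have hnn : ∀ p : ℤ × ℤ, 0 ≤ (hessInvSq (img T p.1 z) * hessInvSq (img T p.2 z)).trace :=
    fun p => cross_nonneg hℓ hT hz p.1 p.2
  calc 48 / nsq z ^ 4 = (hessInvSq (img T 0 z) * hessInvSq (img T 0 z)).trace := by
        rw [img_zero, trace_hessInvSq_sq]
    _ ≤ ∑' p : ℤ × ℤ, (hessInvSq (img T p.1 z) * hessInvSq (img T p.2 z)).trace :=
        hsumm.le_tsum (0, 0) fun p _ => hnn p
    _ = (thermalHess T z * thermalHess T z).trace := hexp.symm

/-! ### Two-sided bounds of `k_T` on the window, uniform in the period `T ≥ 3ℓ` -/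

/-- Window separations are non-zero. [this route] -/
theorem nsq_pos_of_mem_W {ℓ : ℝ} (hℓ : 0 < ℓ) {z : E4} (hz : z ∈ W ℓ) : 0 < nsq z := by
  have h := time_sq_le_nsq z
  have h0 : 0 < z 0 := by linarith [hz.1]
  nlinarith

/-- Window separations have `|z|² ≤ 13ℓ²/8`. [this route] -/
theorem nsq_le_of_mem_W {ℓ : ℝ} {z : E4} (hz : z ∈ W ℓ) : nsq z ≤ 13 * ℓ ^ 2 / 8 := by
  rw [nsq_eq_time_add_spSq]
  obtain ⟨h1, h2, h3⟩ := hz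
  nlinarith

/-- The vacuum floor constant on the window, `k_min(ℓ) = 96/(13ℓ²/8)⁴`. [this route] -/
def kmin (ℓ : ℝ) : ℝ := 96 / (13 * ℓ ^ 2 / 8) ^ 4

/-- The uniform ceiling on the window, `k_max(ℓ) = 32 (C_ℓ S)²`. [this route] -/
def kmax (ℓ : ℝ) : ℝ := 32 * (Cb ℓ * Sζ) ^ 2

/-- `0 < k_min(ℓ)`. [this route] -/
theorem kmin_pos {ℓ : ℝ} (hℓ : 0 < ℓ) : 0 < kmin ℓ := by unfold kmin; positivity

/-- **Thermal ≥ vacuum ≥ floor on the window, for every period `T ≥ 3ℓ`**: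
`k_T(z) ≥ 96/|z|⁸ ≥ k_min(ℓ)`. [this route] -/
theorem kT_lower {ℓ T : ℝ} (hℓ : 0 < ℓ) (hT : 3 * ℓ ≤ T) {z : E4} (hz : z ∈ W ℓ) :
    kmin ℓ ≤ kT T z := by
  have h1 := trace_thermalHess_sq_ge hℓ hT hz
  have h2 : kmin ℓ ≤ 96 / nsq z ^ 4 := by
    unfold kmin
    exact div_le_div_of_nonneg_left (by norm_num) (pow_pos (nsq_pos_of_mem_W hℓ hz) 4)
      (pow_le_pow_left₀ (nsq_nonneg z) (nsq_le_of_mem_W hz) 4)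
  have h3 : 96 / nsq z ^ 4 ≤ 2 * (thermalHess T z * thermalHess T z).trace := by
    have h96 : 96 / nsq z ^ 4 = 2 * (48 / nsq z ^ 4) := by ring
    rw [h96]
    exact mul_le_mul_of_nonneg_left h1 (by norm_num)
  rw [kT_eq]
  nlinarith [sq_nonneg (thermalHess T z).trace]

/-- The uniform ceiling: `k_T(z) ≤ k_max(ℓ)` on the window, every `T ≥ 3ℓ`. [this route] -/
theorem kT_upper {ℓ T : ℝ} (hℓ : 0 < ℓ) (hT : 3 * ℓ ≤ T) {z : E4} (hz : z ∈ W ℓ) :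
    kT T z ≤ kmax ℓ := by
  have hT0 : 0 < T := by linarith
  have hB : ∀ μ ρ : Fin 4, |thermalHess T z μ ρ| ≤ Cb ℓ * Sζ :=
    fun μ ρ => abs_thermalHess_le hℓ hT hz μ ρ
  have hB0 : 0 ≤ Cb ℓ * Sζ := mul_nonneg (Cb_nonneg ℓ) Sζ_nonneg
  have hterm : ∀ μ ρ : Fin 4,
      thermalHess T z μ ρ * thermalHess T z ρ μ ≤ (Cb ℓ * Sζ) * (Cb ℓ * Sζ) := fun μ ρ =>
    (le_abs_self _).trans (by
      rw [abs_mul]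
      exact mul_le_mul (hB μ ρ) (hB ρ μ) (abs_nonneg _) hB0)
  rw [kT_eq, thermalHess_trace hT0, trace_sq_eq_sum]
  have hsum : ∑ μ : Fin 4, ∑ ρ : Fin 4, thermalHess T z μ ρ * thermalHess T z ρ μ ≤
      ∑ _μ : Fin 4, ∑ _ρ : Fin 4, (Cb ℓ * Sζ) * (Cb ℓ * Sζ) :=
    Finset.sum_le_sum fun μ _ => Finset.sum_le_sum fun ρ _ => hterm μ ρ
  have hconst : ∑ _μ : Fin 4, ∑ _ρ : Fin 4, (Cb ℓ * Sζ) * (Cb ℓ * Sζ) = 16 * (Cb ℓ * Sζ) ^ 2 := by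
    simp only [Finset.sum_const, Finset.card_univ, Fintype.card_fin]
    ring
  unfold kmax
  nlinarith



/-! ## §C The slab mode at scale `ℓ`: centre `(ℓ/2)e₀`, radii `ℓ/16 < ℓ/8` -/

/-- Centre of the mode at scale `ℓ`. [this route] -/
def ctr (ℓ : ℝ) : E4 := (ℓ / 2) • e₀

/-- The centre has time coordinate `ℓ/2`. [this route] -/
@[simp] theorem ctr_apply_zero (ℓ : ℝ) : ctr ℓ 0 = ℓ / 2 := by simp [ctr, e₀]
/-- The centre is on the time axis (coordinate `1`). [this route] -/
@[simp] theorem ctr_apply_one (ℓ : ℝ) : ctr ℓ 1 = 0 := by simp [ctr, e₀]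
/-- The centre is on the time axis (coordinate `2`). [this route] -/
@[simp] theorem ctr_apply_two (ℓ : ℝ) : ctr ℓ 2 = 0 := by simp [ctr, e₀]
/-- The centre is on the time axis (coordinate `3`). [this route] -/
@[simp] theorem ctr_apply_three (ℓ : ℝ) : ctr ℓ 3 = 0 := by simp [ctr, e₀]

/-- The smooth bump at scale `ℓ`: `= 1` on `B̄(c_ℓ, ℓ/16)`, supported in `B̄(c_ℓ, ℓ/8)`. [this route] -/
def bump (ℓ : ℝ) (hℓ : 0 < ℓ) : ContDiffBump (ctr ℓ) :=
  ⟨ℓ / 16, ℓ / 8, by positivity, by linarith⟩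

/-- Inner radius `ℓ/16`. [this route] -/
@[simp] theorem bump_rIn (ℓ : ℝ) (hℓ : 0 < ℓ) : (bump ℓ hℓ).rIn = ℓ / 16 := rfl
/-- Outer radius `ℓ/8`. [this route] -/
@[simp] theorem bump_rOut (ℓ : ℝ) (hℓ : 0 < ℓ) : (bump ℓ hℓ).rOut = ℓ / 8 := rfl

/-- The slab mode as a Schwartz test function. [this route] -/
def wfun (ℓ : ℝ) (hℓ : 0 < ℓ) : 𝓢(E4, ℝ) :=
  (bump ℓ hℓ).hasCompactSupport.toSchwartzMap (bump ℓ hℓ).contDiff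

/-- The mode is the bump, pointwise. [this route] -/
@[simp] theorem wfun_apply (ℓ : ℝ) (hℓ : 0 < ℓ) (x : E4) : wfun ℓ hℓ x = bump ℓ hℓ x := rfl

/-- The mode is non-negative. [this route] -/
theorem wfun_nonneg {ℓ : ℝ} (hℓ : 0 < ℓ) (z : E4) : 0 ≤ wfun ℓ hℓ z := (bump ℓ hℓ).nonneg' z

/-- The mode is bounded by `1` (sup-normalised). [this route] -/
theorem wfun_le_one {ℓ : ℝ} (hℓ : 0 < ℓ) (z : E4) : wfun ℓ hℓ z ≤ 1 := (bump ℓ hℓ).le_one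

section Geometry

variable {ℓ : ℝ}

/-- Points of the support ball have time coordinate in `[3ℓ/8, 5ℓ/8]`. [this route] -/
theorem time_mem_of_mem {x : E4} (hx : x ∈ closedBall (ctr ℓ) (ℓ / 8)) :
    3 * ℓ / 8 ≤ x 0 ∧ x 0 ≤ 5 * ℓ / 8 := by
  rw [mem_closedBall, dist_eq_norm] at hx
  have h1 : |(x - ctr ℓ) 0| ≤ ‖x - ctr ℓ‖ := abs_apply_le_norm _ 0
  have h2 : (x - ctr ℓ) 0 = x 0 - ℓ / 2 := by simp
  rw [h2] at h1
  obtain ⟨h3, h4⟩ := abs_le.mp (h1.trans hx)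
  constructor <;> linarith

/-- Points of the support ball have spatial radius `≤ ℓ/8`. [this route] -/
theorem spSq_le_of_mem {x : E4} (hx : x ∈ closedBall (ctr ℓ) (ℓ / 8)) : spSq x ≤ (ℓ / 8) ^ 2 := by
  rw [mem_closedBall, dist_eq_norm] at hx
  have h1 : spSq (x - ctr ℓ) = spSq x := by simp [spSq]
  have h2 : spSq (x - ctr ℓ) ≤ nsq (x - ctr ℓ) := by
    rw [nsq_eq_time_add_spSq]; nlinarith [sq_nonneg ((x - ctr ℓ) 0)]
  rw [nsq_eq_norm_sq, h1] at h2
  have h3 : ‖x - ctr ℓ‖ ^ 2 ≤ (ℓ / 8) ^ 2 := pow_le_pow_left₀ (norm_nonneg _) hx 2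
  linarith

/-- Time reflection preserves the spatial radius. [folklore] -/
theorem spSq_timeReflection (y : E4) : spSq (timeReflection 4 y) = spSq y := by
  simp [spSq, timeReflection_apply]

/-- Time reflection negates the time coordinate. [folklore] -/
theorem timeReflection_apply_zero (y : E4) : timeReflection 4 y 0 = -y 0 := by
  simp [timeReflection_apply]

/-- **The mode geometry lands in the window**: `x` in the support ball and `θy` in it force
`x − y ∈ W_ℓ`. [this route] -/
theorem sub_mem_W {x y : E4} (hx : x ∈ closedBall (ctr ℓ) (ℓ / 8))
    (hy : timeReflection 4 y ∈ closedBall (ctr ℓ) (ℓ / 8)) : x - y ∈ W ℓ := by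
  obtain ⟨hx1, hx2⟩ := time_mem_of_mem hx
  obtain ⟨hy1, hy2⟩ := time_mem_of_mem hy
  rw [timeReflection_apply_zero] at hy1 hy2
  have hsx := spSq_le_of_mem hx
  have hsy := spSq_le_of_mem hy
  rw [spSq_timeReflection] at hsy
  have hsub : spSq (x - y) ≤ 2 * spSq x + 2 * spSq y := by
    simp only [spSq, PiLp.sub_apply]
    nlinarith [sq_nonneg (x 1 + y 1), sq_nonneg (x 2 + y 2), sq_nonneg (x 3 + y 3)]
  simp only [W, Set.mem_setOf_eq, PiLp.sub_apply]
  refine ⟨by linarith, by linarith, by nlinarith⟩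

/-- Reflected balls: `y ∈ B̄(θc, r) ↔ θy ∈ B̄(c, r)`. [folklore] -/
theorem mem_reflBall {y c : E4} {r : ℝ} :
    y ∈ closedBall (timeReflection 4 c) r ↔ timeReflection 4 y ∈ closedBall c r := by
  rw [mem_closedBall, mem_closedBall, ← (timeReflection 4).dist_map y, timeReflection_timeReflection]

/-- Constants are integrable on closed balls. [folklore] -/
theorem integrable_indicator_closedBall (c : E4) (r C : ℝ) :
    Integrable ((closedBall c r).indicator fun _ : E4 => C) := by
  refine IntegrableOn.integrable_indicator ?_ measurableSet_closedBall
  exact integrableOn_const (measure_closedBall_lt_top).ne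

/-- Volumes of balls of radius `r`: `r⁴ · vol B(0,1)`. [folklore] -/
theorem volume_real_closedBall (c : E4) {r : ℝ} (hr : 0 ≤ r) :
    (volume : Measure E4).real (closedBall c r) = r ^ 4 * (volume : Measure E4).real (ball 0 1) := by
  rw [Measure.addHaar_real_closedBall volume c hr, finrank_euclideanSpace_fin]

/-- The support of the mode lies in the open time slab `(ℓ/4, 3ℓ/4)` (so `δ₁ = ℓ/4 > 0`). [this route] -/
theorem wfun_tsupport_slab (hℓ : 0 < ℓ) :
    tsupport (wfun ℓ hℓ : E4 → ℝ) ⊆ {y | ℓ / 4 < y 0 ∧ y 0 < 3 * ℓ / 4} := by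
  intro x hx
  change x ∈ tsupport (bump ℓ hℓ) at hx
  rw [(bump ℓ hℓ).tsupport_eq, bump_rOut] at hx
  obtain ⟨h1, h2⟩ := time_mem_of_mem hx
  exact ⟨by linarith, by linarith⟩

end Geometry

/-! ## §D The smearing chain, generic in a window-pinched density `k`

For a measurable density `k ≥ 0` with `m ≤ k ≤ M` on the window `W_ℓ`, the reflected two-point
smearing `∫∫ w(x) w(θy) k(x − y)` of the mode is at least `m · vol B̄(θc, ℓ/16) · vol B̄(c, ℓ/16)`. -/

section Chain

variable {ℓ : ℝ} (hℓ : 0 < ℓ) (k : E4 → ℝ) {m M : ℝ}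

/-- The two-point density against the reflected mode: `w(θy) k(x−y)`. [this route] -/
def dens2 (x y : E4) : ℝ := bump ℓ hℓ (timeReflection 4 y) * k (x - y)

/-- The two-point density is non-negative. [this route] -/
theorem dens2_nonneg (hk0 : ∀ z, 0 ≤ k z) (x y : E4) : 0 ≤ dens2 hℓ k x y :=
  mul_nonneg ((bump ℓ hℓ).nonneg' _) (hk0 _)

/-- Domination on the window by a constant times the indicator of the reflected support ball.
[this route] -/
theorem dens2_le (hk0 : ∀ z, 0 ≤ k z) (hkM : ∀ z ∈ W ℓ, k z ≤ M) {x : E4}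
    (hx : x ∈ closedBall (ctr ℓ) (ℓ / 8)) (y : E4) :
    ‖dens2 hℓ k x y‖ ≤ (closedBall (timeReflection 4 (ctr ℓ)) (ℓ / 8)).indicator (fun _ => M) y := by
  rw [Real.norm_of_nonneg (dens2_nonneg hℓ k hk0 x y)]
  by_cases hy : y ∈ closedBall (timeReflection 4 (ctr ℓ)) (ℓ / 8)
  · rw [indicator_of_mem hy]
    have hy' := (mem_reflBall).1 hy
    unfold dens2
    calc bump ℓ hℓ (timeReflection 4 y) * k (x - y) ≤ 1 * M :=
          mul_le_mul (bump ℓ hℓ).le_one (hkM _ (sub_mem_W hx hy')) (hk0 _) zero_le_one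
      _ = M := one_mul _
  · rw [indicator_of_notMem hy]
    have hy' : timeReflection 4 y ∉ closedBall (ctr ℓ) (ℓ / 8) := fun h => hy (mem_reflBall.2 h)
    unfold dens2
    have hb : bump ℓ hℓ (timeReflection 4 y) = 0 :=
      (bump ℓ hℓ).zero_of_le_dist (by rw [mem_closedBall, not_le] at hy'; exact hy'.le)
    rw [hb, zero_mul]

/-- Joint measurability of the two-point density. [this route] -/
theorem measurable_dens2_uncurry (hk : Measurable k) : Measurable (Function.uncurry (dens2 hℓ k)) := by
  have h1 : Measurable fun p : E4 × E4 => bump ℓ hℓ (timeReflection 4 p.2) :=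
    ((bump ℓ hℓ).continuous.comp ((timeReflection 4).continuous.comp continuous_snd)).measurable
  have h2 : Measurable fun p : E4 × E4 => k (p.1 - p.2) := hk.comp (measurable_fst.sub measurable_snd)
  exact h1.mul h2

/-- Measurability of the two-point density in `y`. [this route] -/
theorem measurable_dens2 (hk : Measurable k) (x : E4) : Measurable (dens2 hℓ k x) := by
  have h1 : Measurable fun y : E4 => bump ℓ hℓ (timeReflection 4 y) :=
    ((bump ℓ hℓ).continuous.comp (timeReflection 4).continuous).measurable
  have h2 : Measurable fun y : E4 => k (x - y) := hk.comp (measurable_const.sub measurable_id)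
  exact h1.mul h2

/-- For `x` in the support ball the density is integrable in `y`. [this route] -/
theorem integrable_dens2 (hk : Measurable k) (hk0 : ∀ z, 0 ≤ k z) (hkM : ∀ z ∈ W ℓ, k z ≤ M)
    {x : E4} (hx : x ∈ closedBall (ctr ℓ) (ℓ / 8)) : Integrable (dens2 hℓ k x) :=
  Integrable.mono' (integrable_indicator_closedBall _ _ _) (measurable_dens2 hℓ k hk x).aestronglyMeasurable
    (Eventually.of_forall (dens2_le hℓ k hk0 hkM hx))

/-- The smeared density `I(x) = ∫ w(θy) k(x−y) dy`. [this route] -/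
def innerI (x : E4) : ℝ := ∫ y, dens2 hℓ k x y

/-- The smeared density is non-negative. [this route] -/
theorem innerI_nonneg (hk0 : ∀ z, 0 ≤ k z) (x : E4) : 0 ≤ innerI hℓ k x :=
  integral_nonneg (dens2_nonneg hℓ k hk0 x)

/-- The smeared density is bounded by `M · vol B̄(θc, ℓ/8)` on the support ball. [this route] -/
theorem innerI_le (hk0 : ∀ z, 0 ≤ k z) (hkM : ∀ z ∈ W ℓ, k z ≤ M) {x : E4}
    (hx : x ∈ closedBall (ctr ℓ) (ℓ / 8)) :
    ‖innerI hℓ k x‖ ≤ M * (volume : Measure E4).real (closedBall (timeReflection 4 (ctr ℓ)) (ℓ / 8)) := by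
  unfold innerI
  calc ‖∫ y, dens2 hℓ k x y‖
        ≤ ∫ y, (closedBall (timeReflection 4 (ctr ℓ)) (ℓ / 8)).indicator (fun _ => M) y :=
        norm_integral_le_of_norm_le (integrable_indicator_closedBall _ _ _)
          (Eventually.of_forall (dens2_le hℓ k hk0 hkM hx))
    _ = _ := by
        rw [integral_indicator_const _ measurableSet_closedBall, smul_eq_mul, mul_comm]

/-- The inner floor: for `x` in the INNER ball the smeared density is at least
`m · vol B̄(θc, ℓ/16)`. [this route] -/
theorem innerI_ge (hk : Measurable k) (hk0 : ∀ z, 0 ≤ k z) (hkm : ∀ z ∈ W ℓ, m ≤ k z)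
    (hkM : ∀ z ∈ W ℓ, k z ≤ M) {x : E4} (hx : x ∈ closedBall (ctr ℓ) (ℓ / 16)) :
    m * (volume : Measure E4).real (closedBall (timeReflection 4 (ctr ℓ)) (ℓ / 16)) ≤
      innerI hℓ k x := by
  have hx8 : x ∈ closedBall (ctr ℓ) (ℓ / 8) := closedBall_subset_closedBall (by linarith) hx
  unfold innerI
  calc m * (volume : Measure E4).real (closedBall (timeReflection 4 (ctr ℓ)) (ℓ / 16))
        = ∫ y, (closedBall (timeReflection 4 (ctr ℓ)) (ℓ / 16)).indicator (fun _ => m) y := by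
        rw [integral_indicator_const _ measurableSet_closedBall, smul_eq_mul, mul_comm]
    _ ≤ ∫ y, dens2 hℓ k x y := by
        refine integral_mono (integrable_indicator_closedBall _ _ _)
          (integrable_dens2 hℓ k hk hk0 hkM hx8) fun y => ?_
        by_cases hy : y ∈ closedBall (timeReflection 4 (ctr ℓ)) (ℓ / 16)
        · rw [indicator_of_mem hy]
          have hy' := (mem_reflBall).1 hy
          have hy8 : timeReflection 4 y ∈ closedBall (ctr ℓ) (ℓ / 8) :=
            closedBall_subset_closedBall (by linarith) hy'
          have hb : bump ℓ hℓ (timeReflection 4 y) = 1 :=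
            (bump ℓ hℓ).one_of_mem_closedBall (by simpa using hy')
          show _ ≤ dens2 hℓ k x y
          unfold dens2
          rw [hb, one_mul]
          exact hkm _ (sub_mem_W hx8 hy8)
        · rw [indicator_of_notMem hy]
          exact dens2_nonneg hℓ k hk0 x y

/-- The outer integrand `w(x) I(x)`. [this route] -/
def outerF (x : E4) : ℝ := bump ℓ hℓ x * innerI hℓ k x

/-- The outer integrand is non-negative. [this route] -/
theorem outerF_nonneg (hk0 : ∀ z, 0 ≤ k z) (x : E4) : 0 ≤ outerF hℓ k x :=
  mul_nonneg ((bump ℓ hℓ).nonneg' _) (innerI_nonneg hℓ k hk0 x)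

/-- The outer integrand is measurable (Fubini measurability of the inner integral). [this route] -/
theorem measurable_outerF (hk : Measurable k) : Measurable (outerF hℓ k) := by
  have h1 : Measurable fun x : E4 => bump ℓ hℓ x := (bump ℓ hℓ).continuous.measurable
  have h2 : StronglyMeasurable (innerI hℓ k) :=
    StronglyMeasurable.integral_prod_right (f := dens2 hℓ k)
      (measurable_dens2_uncurry hℓ k hk).stronglyMeasurable
  exact h1.mul h2.measurable

/-- Domination of the outer integrand by a constant times the indicator of the support ball. [this route] -/
theorem outerF_le (hk0 : ∀ z, 0 ≤ k z) (hkM : ∀ z ∈ W ℓ, k z ≤ M) (x : E4) :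
    ‖outerF hℓ k x‖ ≤ (closedBall (ctr ℓ) (ℓ / 8)).indicator
      (fun _ => M * (volume : Measure E4).real (closedBall (timeReflection 4 (ctr ℓ)) (ℓ / 8))) x := by
  rw [Real.norm_of_nonneg (outerF_nonneg hℓ k hk0 x)]
  by_cases hx : x ∈ closedBall (ctr ℓ) (ℓ / 8)
  · rw [indicator_of_mem hx]
    unfold outerF
    have hI : innerI hℓ k x ≤ _ := (le_abs_self _).trans ((Real.norm_eq_abs _).symm.le.trans
      (innerI_le hℓ k hk0 hkM hx))
    calc bump ℓ hℓ x * innerI hℓ k x ≤ 1 * innerI hℓ k x :=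
          mul_le_mul_of_nonneg_right (bump ℓ hℓ).le_one (innerI_nonneg hℓ k hk0 x)
      _ = innerI hℓ k x := one_mul _
      _ ≤ _ := hI
  · rw [indicator_of_notMem hx]
    unfold outerF
    have hb : bump ℓ hℓ x = 0 :=
      (bump ℓ hℓ).zero_of_le_dist (by rw [mem_closedBall, not_le] at hx; exact hx.le)
    rw [hb, zero_mul]

/-- The outer integrand is integrable. [this route] -/
theorem integrable_outerF (hk : Measurable k) (hk0 : ∀ z, 0 ≤ k z) (hkM : ∀ z ∈ W ℓ, k z ≤ M) :
    Integrable (outerF hℓ k) :=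
  Integrable.mono' (integrable_indicator_closedBall _ _ _) (measurable_outerF hℓ k hk).aestronglyMeasurable
    (Eventually.of_forall (outerF_le hℓ k hk0 hkM))

/-- **The outer floor**: `m · vol B̄(θc, ℓ/16) · vol B̄(c, ℓ/16) ≤ ∫ w I`. [this route] -/
theorem integral_outerF_ge (hk : Measurable k) (hk0 : ∀ z, 0 ≤ k z) (hkm : ∀ z ∈ W ℓ, m ≤ k z)
    (hkM : ∀ z ∈ W ℓ, k z ≤ M) :
    m * (volume : Measure E4).real (closedBall (timeReflection 4 (ctr ℓ)) (ℓ / 16)) *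
      (volume : Measure E4).real (closedBall (ctr ℓ) (ℓ / 16)) ≤ ∫ x, outerF hℓ k x := by
  set M' : ℝ := m * (volume : Measure E4).real (closedBall (timeReflection 4 (ctr ℓ)) (ℓ / 16))
    with hM'
  calc M' * (volume : Measure E4).real (closedBall (ctr ℓ) (ℓ / 16))
        = ∫ x, (closedBall (ctr ℓ) (ℓ / 16)).indicator (fun _ => M') x := by
        rw [integral_indicator_const _ measurableSet_closedBall, smul_eq_mul, mul_comm]
    _ ≤ ∫ x, outerF hℓ k x := by
        refine integral_mono (integrable_indicator_closedBall _ _ _)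
          (integrable_outerF hℓ k hk hk0 hkM) fun x => ?_
        by_cases hx : x ∈ closedBall (ctr ℓ) (ℓ / 16)
        · rw [indicator_of_mem hx]
          have hb : bump ℓ hℓ x = 1 := (bump ℓ hℓ).one_of_mem_closedBall (by simpa using hx)
          show M' ≤ outerF hℓ k x
          unfold outerF
          rw [hb, one_mul, hM']
          exact innerI_ge hℓ k hk hk0 hkm hkM hx
        · rw [indicator_of_notMem hx]
          exact outerF_nonneg hℓ k hk0 x

/-- **Wick form ↔ density form**: for ANY matrix covariance `G` with `tr G(z)G(−z) = k(z)`, the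
reflected two-ring functional of the mode is the outer integral of the chain. [this route] -/
theorem ring2_eq_integral_outerF {G : E4 → Matrix (Fin 6) (Fin 6) ℝ}
    (hG : ∀ z, (G z * G (-z)).trace = k z) :
    (∫ x, ∫ y, wfun ℓ hℓ x * thetaTest 4 (wfun ℓ hℓ) y * (G (x - y) * G (y - x)).trace) =
      ∫ x, outerF hℓ k x := by
  refine integral_congr_ae (Eventually.of_forall fun x => ?_)
  show (∫ y, wfun ℓ hℓ x * thetaTest 4 (wfun ℓ hℓ) y * (G (x - y) * G (y - x)).trace) =
    outerF hℓ k x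
  unfold outerF innerI
  rw [← integral_const_mul]
  refine integral_congr_ae (Eventually.of_forall fun y => ?_)
  show wfun ℓ hℓ x * thetaTest 4 (wfun ℓ hℓ) y * (G (x - y) * G (y - x)).trace =
    bump ℓ hℓ x * dens2 hℓ k x y
  rw [thetaTest_apply, wfun_apply, wfun_apply, dens2, ← hG (x - y), neg_sub]
  ring

/-- **The generic floor**: `m (ℓ/16)⁸ vol(B₁)² ≤ ∫∫ w (θw) tr G G`. [this route] -/
theorem ring2_floor (hk : Measurable k) (hk0 : ∀ z, 0 ≤ k z) (hkm : ∀ z ∈ W ℓ, m ≤ k z)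
    (hkM : ∀ z ∈ W ℓ, k z ≤ M) {G : E4 → Matrix (Fin 6) (Fin 6) ℝ}
    (hG : ∀ z, (G z * G (-z)).trace = k z) :
    m * ((ℓ / 16) ^ 4 * (volume : Measure E4).real (ball 0 1)) *
        ((ℓ / 16) ^ 4 * (volume : Measure E4).real (ball 0 1)) ≤
      ∫ x, ∫ y, wfun ℓ hℓ x * thetaTest 4 (wfun ℓ hℓ) y * (G (x - y) * G (y - x)).trace := by
  rw [ring2_eq_integral_outerF hℓ k hG]
  have h := integral_outerF_ge hℓ k hk hk0 hkm hkM
  rwa [volume_real_closedBall _ (by positivity : (0:ℝ) ≤ ℓ / 16),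
    volume_real_closedBall _ (by positivity : (0:ℝ) ≤ ℓ / 16)] at h

end Chain



/-! ## §E The thermal and vacuum ring functionals; the floors; the separation -/

/-- **The thermal free-Maxwell two-ring functional** at the reflected pair `(w, θw)`, inverse
temperature (time period) `T`: `R₂^T(w) = ∫∫ w(x)(θw)(y) tr G_T(x−y)G_T(y−x)` — one half of the
thermal Gaussian (Wick) covariance of the smeared Wick squares `F²(w)`, `F²(θw)`; the model analogue
of the crux's reflected plaquette-energy covariance `Qrp` on the `T`-periodic torus. [this route] -/
def thermalRing2 (T : ℝ) (w : 𝓢(E4, ℝ)) : ℝ :=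
  ∫ x, ∫ y, w x * thetaTest 4 w y * (thermalKernel T (x - y) * thermalKernel T (y - x)).trace

/-- **The thermal free-Maxwell three-ring functional** `R₃^T(f,g,h)` — one eighth of the thermal
Gaussian third cumulant of `F²(f), F²(g), F²(h)`; the model analogue of NT's clause-(ii) connected
three-point function at inverse temperature `T`. [this route] -/
def thermalRing3 (T : ℝ) (f g h : 𝓢(E4, ℝ)) : ℝ :=
  ∫ x, ∫ y, ∫ z, f x * g y * h z *
    (thermalKernel T (x - y) * thermalKernel T (y - z) * thermalKernel T (z - x)).trace

/-- **The vacuum (`T = ∞`) two-ring functional** `R₂(w) = ∫∫ w(x)(θw)(y) tr G(x−y)G(y−x)` — verbatim the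
tree's `maxwellRing2`. [folklore] -/
def vacuumRing2 (w : 𝓢(E4, ℝ)) : ℝ :=
  ∫ x, ∫ y, w x * thetaTest 4 w y * (maxwellKernel (x - y) * maxwellKernel (y - x)).trace

/-- **The vacuum three-ring functional** `R₃(f,g,h)` — verbatim the tree's `maxwellRing3`. [folklore] -/
def vacuumRing3 (f g h : 𝓢(E4, ℝ)) : ℝ :=
  ∫ x, ∫ y, ∫ z, f x * g y * h z *
    (maxwellKernel (x - y) * maxwellKernel (y - z) * maxwellKernel (z - x)).trace

/-- The vacuum odd ring vanishes pointwise (`treeLevelSkewness_vanishes`). [folklore] -/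
theorem vacuumOddRing_eq_zero (x y z : E4) :
    (maxwellKernel (x - y) * maxwellKernel (y - z) * maxwellKernel (z - x)).trace = 0 :=
  treeLevelSkewness_vanishes _ _ _ (hessInvSq_isSymm _) (hessInvSq_isSymm _) (hessInvSq_isSymm _)
    (hessInvSq_trace _) (hessInvSq_trace _) (hessInvSq_trace _)

/-- `R₃ ≡ 0`. [folklore] -/
theorem vacuumRing3_eq_zero (f g h : 𝓢(E4, ℝ)) : vacuumRing3 f g h = 0 := by
  simp [vacuumRing3, vacuumOddRing_eq_zero]

/-- The vacuum (`T = ∞`) even-ring density `k_∞(z) = tr G(z)G(−z) = 96/|z|⁸`. [folklore] -/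
def kvac (z : E4) : ℝ := 96 / nsq z ^ 4

/-- The vacuum even ring in closed form: `tr G(z)G(−z) = 96/|z|⁸`. [folklore] -/
theorem trace_ring_eq_kvac (z : E4) : (maxwellKernel z * maxwellKernel (-z)).trace = kvac z := by
  rw [maxwellKernel_neg, maxwellKernel, trace_K_mul_K_of_isSymm (hessInvSq_isSymm z) (hessInvSq_isSymm z),
    hessInvSq_trace, trace_hessInvSq_sq, kvac]
  ring

/-- The thermal even ring is `k_T`, by definition. [this route] -/
theorem trace_ring_eq_kT (T : ℝ) (z : E4) : (thermalKernel T z * thermalKernel T (-z)).trace = kT T z :=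
  rfl

/-- `k_∞ ≥ 0`. [folklore] -/
theorem kvac_nonneg (z : E4) : 0 ≤ kvac z := by
  unfold kvac
  exact div_nonneg (by norm_num) (pow_nonneg (nsq_nonneg z) 4)

/-- `k_∞` is measurable. [folklore] -/
theorem measurable_kvac : Measurable kvac :=
  measurable_const.div (continuous_nsq.measurable.pow_const 4)

/-- `k_∞ ≥ k_min(ℓ)` on the window. [this route] -/
theorem kvac_lower {ℓ : ℝ} (hℓ : 0 < ℓ) {z : E4} (hz : z ∈ W ℓ) : kmin ℓ ≤ kvac z := by
  unfold kmin kvac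
  exact div_le_div_of_nonneg_left (by norm_num) (pow_pos (nsq_pos_of_mem_W hℓ hz) 4)
    (pow_le_pow_left₀ (nsq_nonneg z) (nsq_le_of_mem_W hz) 4)

/-- `k_∞ ≤ 96/(9ℓ²/16)⁴` on the window. [this route] -/
theorem kvac_upper {ℓ : ℝ} (hℓ : 0 < ℓ) {z : E4} (hz : z ∈ W ℓ) :
    kvac z ≤ 96 / (9 * ℓ ^ 2 / 16) ^ 4 := by
  have h1 : 9 * ℓ ^ 2 / 16 ≤ nsq z := by
    have := time_sq_le_nsq z
    nlinarith [hz.1]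
  unfold kvac
  exact div_le_div_of_nonneg_left (by norm_num) (by positivity) (pow_le_pow_left₀ (by positivity) h1 4)

/-- **Thermal dominates vacuum on the window, termwise** (`T ≥ 3ℓ`): `k_∞(z) ≤ k_T(z)`. [this route] -/
theorem kvac_le_kT {ℓ T : ℝ} (hℓ : 0 < ℓ) (hT : 3 * ℓ ≤ T) {z : E4} (hz : z ∈ W ℓ) :
    kvac z ≤ kT T z := by
  have h1 := trace_thermalHess_sq_ge hℓ hT hz
  rw [kT_eq, kvac]
  have h96 : 96 / nsq z ^ 4 = 2 * (48 / nsq z ^ 4) := by ring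
  rw [h96]
  nlinarith [sq_nonneg (thermalHess T z).trace]

/-- The volume of the unit ball of `ℝ⁴`. [folklore] -/
def unitBallVol : ℝ := (volume : Measure E4).real (ball 0 1)

/-- The unit ball has positive volume. [folklore] -/
theorem unitBallVol_pos : 0 < unitBallVol := by
  rw [unitBallVol, measureReal_def]
  exact ENNReal.toReal_pos (measure_ball_pos volume (0 : E4) one_pos).ne' measure_ball_lt_top.ne

/-- **The `ℓ`-free, `T`-free floor constant** `κ = 2 · 96/(13/8)⁴ · (vol B₁/16⁴)²`. [this route] -/
def κTh : ℝ :=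
  2 * (96 / (((13 : ℝ) / 8)) ^ 4 * (((1 : ℝ) / 16) ^ 4 * unitBallVol) * (((1 : ℝ) / 16) ^ 4 * unitBallVol))

/-- `κ > 0`. [this route] -/
theorem κTh_pos : 0 < κTh := by
  have hV := unitBallVol_pos
  unfold κTh
  positivity

/-- `κ` is the window floor times the two inner-ball volumes, at every scale (`−8 = −2·dim[F²]` homogeneity). [this route] -/
theorem κTh_eq {ℓ : ℝ} (hℓ : 0 < ℓ) :
    κTh = 2 * (kmin ℓ * ((ℓ / 16) ^ 4 * unitBallVol) * ((ℓ / 16) ^ 4 * unitBallVol)) := by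
  unfold κTh kmin
  have hℓ0 : ℓ ≠ 0 := hℓ.ne'
  field_simp

/-- The vacuum floor at scale `ℓ` (the `T = ∞` member; FRM's mirror floor in slab geometry).
[this route] -/
theorem vacuumRing2_floor {ℓ : ℝ} (hℓ : 0 < ℓ) : κTh ≤ 2 * vacuumRing2 (wfun ℓ hℓ) := by
  have h := ring2_floor hℓ kvac measurable_kvac kvac_nonneg (fun z hz => kvac_lower hℓ hz)
    (fun z hz => kvac_upper hℓ hz) (G := maxwellKernel) trace_ring_eq_kvac
  rw [κTh_eq hℓ]
  unfold vacuumRing2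
  unfold unitBallVol
  linarith

/-- **The thermal floor at scale `ℓ`, uniform in the period `T ≥ 3ℓ`**. [this route] -/
theorem thermalRing2_floor {ℓ T : ℝ} (hℓ : 0 < ℓ) (hT : 3 * ℓ ≤ T) :
    κTh ≤ 2 * thermalRing2 T (wfun ℓ hℓ) := by
  have hT0 : 0 < T := by linarith
  have h := ring2_floor hℓ (kT T) (measurable_kT hT0) (kT_nonneg T) (fun z hz => kT_lower hℓ hT hz)
    (fun z hz => kT_upper hℓ hT hz) (G := thermalKernel T) (trace_ring_eq_kT T)
  rw [κTh_eq hℓ]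
  unfold thermalRing2
  unfold unitBallVol
  linarith

/-- **MAIN THEOREM (the rung): the thermal free-Maxwell zero-temperature floor.**
One constant `κ > 0` such that at EVERY scale `ℓ > 0` one `[0,1]`-valued slab mode `w_ℓ`
(supported in the time slab `ℓ/4 < x₀ < 3ℓ/4`) has reflected Wick-square covariance
`2·R₂^T(w_ℓ) ≥ κ` for EVERY inverse temperature `T ≥ 3ℓ` — uniformly as `T → ∞` — and the same
floor for the vacuum functional `2·R₂(w_ℓ)`.  This is the free-field (formal `β → ∞`, `G = U(1)`,
continuum) analogue of the crux `ZeroTemperatureFloors`' floor clause: a reflected plaquette-energy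
covariance floor `ε > 0` surviving the zero-temperature limit along the time direction, for a test
function supported in a fixed positive-time slab.  No `T → ∞` limit is taken: every cross-image
term of the thermal density is non-negative on the window (`cross_nonneg`). [this route] -/
theorem thermalMaxwell_zeroTemperatureFloor :
    ∃ κ : ℝ, 0 < κ ∧ ∀ ℓ : ℝ, 0 < ℓ →
      ∃ w : 𝓢(E4, ℝ), tsupport (w : E4 → ℝ) ⊆ {y | ℓ / 4 < y 0 ∧ y 0 < 3 * ℓ / 4} ∧
        (∀ z, 0 ≤ w z ∧ w z ≤ 1) ∧ κ ≤ 2 * vacuumRing2 w ∧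
        ∀ T : ℝ, 3 * ℓ ≤ T → κ ≤ 2 * thermalRing2 T w :=
  ⟨κTh, κTh_pos, fun ℓ hℓ => ⟨wfun ℓ hℓ, wfun_tsupport_slab hℓ,
    fun z => ⟨wfun_nonneg hℓ z, wfun_le_one hℓ z⟩, vacuumRing2_floor hℓ,
    fun _ hT => thermalRing2_floor hℓ hT⟩⟩

/-- **The rung in the quantifier shape of the crux's floor clause** (`ZeroTemperatureFloors`:
`∃ v δ₁ δ₂ ε β₅ Λ₅, 0 < δ₁ ∧ tsupport v ⊆ {δ₁ < y₀ < δ₂} ∧ 0 < ε ∧ ∀ β ≥ β₅, ∀ L, Λ₅ ≤ a(β)L →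
∃ k₀, ∀ k ≥ k₀, ε ≤ Qrp β (2L+1) (2^k(2L+1)) (a β) v`), with the lattice covariance `Qrp` at time
extent `2^k(2L+1)` replaced by its free-Maxwell value `2·R₂^T` at the physical period `T = 2^k·P`
(`P ≥ P₅` the spatial period; `β` is absent in the free model, which is already its formal
`β → ∞` limit): ONE test function, ONE `ε`, the floor holding along EVERY doubling chain of periods
with `k₀ = 0`. [this route] -/
theorem thermalMaxwell_zeroTemperatureFloor_cruxShape :
    ∃ (v : 𝓢(E4, ℝ)) (δ₁ δ₂ ε P₅ : ℝ), 0 < δ₁ ∧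
      tsupport (v : E4 → ℝ) ⊆ {y | δ₁ < y 0 ∧ y 0 < δ₂} ∧ 0 < ε ∧
      ∀ P : ℝ, P₅ ≤ P → ∃ k₀ : ℕ, ∀ k : ℕ, k₀ ≤ k → ε ≤ 2 * thermalRing2 (2 ^ k * P) v := by
  refine ⟨wfun 1 one_pos, 1 / 4, 3 / 4, κTh, 3, by norm_num, ?_, κTh_pos, fun P hP => ⟨0, fun k _ => ?_⟩⟩
  · simpa using wfun_tsupport_slab (ℓ := 1) one_pos
  · refine thermalRing2_floor one_pos ?_
    have h1 : (1 : ℝ) ≤ 2 ^ k := one_le_pow₀ (by norm_num)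
    nlinarith

/-! ### The separation: NT's clause (ii) analogue is FALSE in the same model, at every temperature -/

/-- **The thermal odd ring vanishes at all points and all temperatures** (`T > 0`):
`tr G_T(x−y)G_T(y−z)G_T(z−x) = 0` — `treeLevelSkewness_vanishes` at the periodised Hessians, which
are symmetric and traceless (the image sum of harmonic Hessians is harmonic). [this route] -/
theorem thermalOddRing_eq_zero {T : ℝ} (hT : 0 < T) (x y z : E4) :
    (thermalKernel T (x - y) * thermalKernel T (y - z) * thermalKernel T (z - x)).trace = 0 :=
  treeLevelSkewness_vanishes _ _ _ (thermalHess_isSymm _ _) (thermalHess_isSymm _ _)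
    (thermalHess_isSymm _ _) (thermalHess_trace hT _) (thermalHess_trace hT _) (thermalHess_trace hT _)

/-- `R₃^T ≡ 0` for all test functions, every `T > 0`. [this route] -/
theorem thermalRing3_eq_zero {T : ℝ} (hT : 0 < T) (f g h : 𝓢(E4, ℝ)) : thermalRing3 T f g h = 0 := by
  simp [thermalRing3, thermalOddRing_eq_zero hT]

/-- **NT clause (ii) fails in the thermal free-Maxwell model at every temperature**: the connected
three-point functional of the Wick square (`κ₃ = 8·R₃^T`) admits NO floor `ε > 0`, for any triple
of test functions — while the zero-temperature floor above (clause-(iii)/crux side) holds. [this route] -/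
theorem thermalMaxwell_NT_clauseII_false {T : ℝ} (hT : 0 < T) :
    ¬ ∃ (f g h : 𝓢(E4, ℝ)) (ε : ℝ), 0 < ε ∧ ε ≤ |8 * thermalRing3 T f g h| := by
  rintro ⟨f, g, h, ε, hε, hle⟩
  rw [thermalRing3_eq_zero hT] at hle
  norm_num at hle
  linarith

/-- The vacuum version (`T = ∞`): `vacuumRing3 ≡ 0` admits no floor either. [folklore] -/
theorem maxwell_NT_clauseII_false :
    ¬ ∃ (f g h : 𝓢(E4, ℝ)) (ε : ℝ), 0 < ε ∧ ε ≤ |8 * vacuumRing3 f g h| := by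
  rintro ⟨f, g, h, ε, hε, hle⟩
  rw [vacuumRing3_eq_zero] at hle
  norm_num at hle
  linarith

/-- **The separation packaged**: in ONE decided model (thermal free Maxwell, all periods) the crux's
floor-clause analogue is TRUE, uniformly down to zero temperature, while the sub-problem statement's
clause-(ii) analogue is FALSE at every temperature and in the vacuum — a witness that
`ZeroTemperatureFloors` has content not implied by, and not implying, `NT`'s printed regime.
[this route] -/
theorem thermalMaxwell_separates :
    (∃ κ : ℝ, 0 < κ ∧ ∀ ℓ : ℝ, 0 < ℓ →
      ∃ w : 𝓢(E4, ℝ), tsupport (w : E4 → ℝ) ⊆ {y | ℓ / 4 < y 0 ∧ y 0 < 3 * ℓ / 4} ∧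
        (∀ z, 0 ≤ w z ∧ w z ≤ 1) ∧ κ ≤ 2 * vacuumRing2 w ∧
        ∀ T : ℝ, 3 * ℓ ≤ T → κ ≤ 2 * thermalRing2 T w) ∧
    (∀ T : ℝ, 0 < T → ¬ ∃ (f g h : 𝓢(E4, ℝ)) (ε : ℝ), 0 < ε ∧ ε ≤ |8 * thermalRing3 T f g h|) ∧
    ¬ ∃ (f g h : 𝓢(E4, ℝ)) (ε : ℝ), 0 < ε ∧ ε ≤ |8 * vacuumRing3 f g h| :=
  ⟨thermalMaxwell_zeroTemperatureFloor, fun _ hT => thermalMaxwell_NT_clauseII_false hT,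
    maxwell_NT_clauseII_false⟩


end Summit.QuantumFields.YangMills.Cruxes.ZeroTemperatureFloors.MaxwellRung

end
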